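import Literature.NumberTheory.Automorphic.WhittakerCoeffLevelOneNonvanishing
import Literature.NumberTheory.Automorphic.WhittakerCoeffTranslateUnramified
import Literature.NumberTheory.Automorphic.UnipotentConjHaarChar
import HarnessLib

/-!
# Non-vanishing of the TRANSLATED Whittaker coefficient of a level-one cusp form over a general number
field

Topic `NumberTheory/Automorphic`; namespace `Literature.NumberTheory.Automorphic`. Theorems only.
`exists_whittakerCoeff_smoothedForm_ne_zero_sndHom_mem_glFiniteIntegralLevel`
(`WhittakerCoeffLevelOneNonvanishing`) shows, for a number field with TRIVIAL different, that the global
Whittaker coefficient `W = W_{S_η f}` of a level-one smoothed cusp form is non-zero at a point with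
integral finite part; the hypothesis on the different is genuinely needed there (for `𝔡_K ≠ 1`, `n ≥ 2`,
`W(g_∞ · 1_f) ≡ 0`). Here the translated statement valid over EVERY number field is proved: given a torus
element `τ ∈ (𝔸_Kˣ)ⁿ` whose `v`-component, at every finite place, is a diagonal shift `diag(d)` of
constant ratio `a_v` with `ψ_{K,v}(a_v ·)` of conductor `𝒪_v` (`exists_whittakerShiftTorus`), there is
`g` with `g_f ∈ GL_n(𝒪̂_K)` and `W(diag(τ) g) ≠ 0`
(`exists_whittakerCoeff_smoothedForm_translate_ne_zero_sndHom_mem_glFiniteIntegralLevel`). The proof is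
the peeling argument of the source file (`exists_apply_ne_zero_forall_localComponent_mem_glInt`, abstract
in `W`) applied to the left translate `W^τ = W(diag τ ·)`: it is an unramified torus datum at every place
by the translated Shintani formula (`exists_isTorusUnramifiedAt_whittakerCoeff_smoothedForm_translate`),
`N_n(𝔸_K)`-equivariant up to scalars (`diag(τ) ι_v(u) = (diag(τ) ι_v(u) diag(τ)⁻¹) diag(τ)` with a
unipotent first factor, `whittakerCoeff_unipotent_mul`), and central up to scalars (central character of
`Π`), and it is non-zero somewhere by genericity. Cogdell (2004), §1.1, §3.1; Shalika (1974), Thm. 5.9.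

## References

* J. W. Cogdell, *Analytic theory of L-functions for GL_n* (2004), §1.1, §3.1 Thm. 3.3
  [CogdellAnalyticTheory2004].
* J. A. Shalika, *The multiplicity one theorem for GL_n*, Ann. of Math. 100 (1974), §5 Thm. 5.9
  [Shalika1974].
-/

noncomputable section

open MeasureTheory Measure NumberField IsDedekindDomain Matrix Set ValuativeRel
open scoped MatrixGroups ComplexConjugate
open Literature.NumberTheory.GaloisRepresentations (ideleGroup localUnits)

namespace Literature.NumberTheory.Automorphic

section LevelOneTranslate

variable {n : ℕ} {K : Type} [Field K] [NumberField K]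
  {μ : Measure (AdelicGroupData.gl n K).automorphicQuotient} [(AdelicGroupData.gl n K).IsAutomorphicMeasure μ]

variable [MeasurableSpace (AdeleRing (𝓞 K) K)] [BorelSpace (AdeleRing (𝓞 K) K)]
variable [MeasurableSpace (GL (Fin n) (AdeleRing (𝓞 K) K))] [BorelSpace (GL (Fin n) (AdeleRing (𝓞 K) K))]

/-- **The translated Whittaker coefficient of an everywhere-unramified smoothed cusp form is non-zero at
a point with integral finite part, over every number field.** Let `Π` be a cuspidal automorphic
representation of `GL_n(𝔸_K)`, `n ≥ 1`, with a Satake family `α` off the empty set, `η` a test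
function left invariant under `K(1)`, `f ∈ Π` with `S_η f ≠ 0`, and `τ ∈ (𝔸_Kˣ)ⁿ` a torus element whose
`v`-component at every finite `v` is `diag(d)` with constant ratios `a_v`, `ψ_{K,v}(a_v ·)` of conductor
`𝒪_v`. Then `W_{S_η f}(diag(τ) g) ≠ 0` for some `g` with `g_f ∈ GL_n(𝒪̂_K)`.
[cite: CogdellAnalyticTheory2004, §1.1 and §3.1 Thm. 3.3] [cite: Shalika1974, §5 Thm. 5.9] -/
theorem exists_whittakerCoeff_smoothedForm_translate_ne_zero_sndHom_mem_glFiniteIntegralLevel (hn : 1 ≤ n)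
    (P : CuspidalAutomorphicRepGL n K μ) {α : SatakeFamily K} (hα : IsSatakeFamilyOf P ∅ α)
    (ν₀ : Measure ↥(adelicUnipotent n K)) [IsHaarMeasure ν₀]
    {η : (AdelicGroupData.gl n K).Adelic → ℝ} (hη : IsTestFunctionGL n K η)
    (hηK : ∀ k : (AdelicGroupData.gl n K).Adelic, k ∈ principalCongruenceLevel n K ⊤ →
      ∀ g : (AdelicGroupData.gl n K).Adelic, η (k * g) = η g)
    (f : P.1.toSubmodule) (hne : smoothedForm η (f : (AdelicGroupData.gl n K).L2 μ) ≠ 0)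
    (τ : Fin n → ideleGroup K)
    (hτψ : ∀ v : HeightOneSpectrum (𝓞 K), ∃ (d : Fin n → (v.adicCompletion K)ˣ) (a : (v.adicCompletion K)ˣ),
      localComponent v (glDiagonal n (AdeleRing (𝓞 K) K) τ) = diagonalGL (Fin n) (v.adicCompletion K) d ∧
      (∀ i j : Fin n, (i : ℕ) + 1 = j →
        (d i : v.adicCompletion K) * ((d j)⁻¹ : (v.adicCompletion K)ˣ) = a) ∧
      (∀ c ∈ 𝒪[v.adicCompletion K], (adeleAddChar K).adicComponent v (a * c) = 1) ∧
      ∀ ϖ : v.adicCompletion K, Valued.v ϖ = WithZero.exp (-1 : ℤ) →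
        ∃ c ∈ 𝒪[v.adicCompletion K], (adeleAddChar K).adicComponent v (a * (ϖ⁻¹ * c)) ≠ 1) :
    ∃ g : GL (Fin n) (AdeleRing (𝓞 K) K), GLn.sndHom n K g ∈ glFiniteIntegralLevel n K ∧
      whittakerCoeff ν₀ (unipotentTateDomain n K) (adeleAddChar K)
        (invQuot (AdelicGroupData.gl n K) (smoothedForm η (f : (AdelicGroupData.gl n K).L2 μ)))
        (glDiagonal n (AdeleRing (𝓞 K) K) τ * g) ≠ 0 := by
  classical
  haveI := isMulRightInvariant_of_isHaarMeasure_adelicUnipotent ν₀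
  have hψ : IsGlobalAddChar K (adeleAddChar K) := isGlobalAddChar_adeleAddChar (K := K)
  have h𝓕 : IsFundamentalDomain ↥(rationalUnipotent n K) (unipotentTateDomain n K) ν₀ :=
    isFundamentalDomain_unipotentTateDomain ν₀
  have h𝓕c : IsCompact (closure (unipotentTateDomain n K)) := isCompact_closure_unipotentTateDomain
  set φ : GL (Fin n) (AdeleRing (𝓞 K) K) → ℂ :=
    invQuot (AdelicGroupData.gl n K) (smoothedForm η (f : (AdelicGroupData.gl n K).L2 μ)) with hφ
  have hφinv : IsLeftInvariant (AdelicGroupData.gl n K) φ := isLeftInvariant_invQuot _ _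
  set W : GL (Fin n) (AdeleRing (𝓞 K) K) → ℂ :=
    whittakerCoeff ν₀ (unipotentTateDomain n K) (adeleAddChar K) φ with hW
  set D : GL (Fin n) (AdeleRing (𝓞 K) K) := glDiagonal n (AdeleRing (𝓞 K) K) τ with hD
  set WT : GL (Fin n) (AdeleRing (𝓞 K) K) → ℂ := fun g => W (D * g) with hWT
  -- genericity: `W(g₀) ≠ 0`, so `W^τ(D⁻¹ g₀) ≠ 0`
  obtain ⟨g₀, hg₀⟩ := exists_whittakerCoeff_invQuot_smoothedForm_ne_zero_of_one_le hn hη.continuous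
    hη.hasCompactSupport (P.le_cuspidalSubspace f.2) hne ν₀
  have hg₀' : WT (D⁻¹ * g₀) ≠ 0 := by
    show W (D * (D⁻¹ * g₀)) ≠ 0
    rwa [mul_inv_cancel_left]
  -- the central character
  obtain ⟨ω, -, -, -, -, -, hωφ⟩ := P.exists_centralCharacter_smoothedForm
  -- the unramified structure of `W^τ` at every finite place
  have hT : ∀ v : HeightOneSpectrum (𝓞 K), ∃ (ϖ : (v.adicCompletion K)ˣ) (x : Fin n → ℂ),
      IsTorusUnramifiedAt n K WT v ϖ x ∧
        ∀ (N : ℕ) (g : GL (Fin n) (AdeleRing (𝓞 K) K)),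
          ∃ c : ℂ, WT (g * GLn.ofLocal n K v ((heckeDiag n ϖ n)⁻¹ ^ N)) = c * WT g := by
    intro v
    obtain ⟨x, hx⟩ := exists_univ_val_map_eq (hα.card_eq (Set.notMem_empty v))
    obtain ⟨d, a, hTv, hd, hψa, hψa'⟩ := hτψ v
    have htop : (⊤ : Ideal (𝓞 K)) ≠ 0 := top_ne_bot
    obtain ⟨ϖ, hTu⟩ := exists_isTorusUnramifiedAt_whittakerCoeff_smoothedForm_translate P hα htop
      (Set.notMem_empty v) (not_asIdeal_dvd_top v) hη.continuous hη.hasCompactSupport hηK f hx h𝓕 h𝓕c hψ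
      hTv hd hψa hψa'
    refine ⟨ϖ, x, hTu, fun N g => ?_⟩
    -- `ι_v((ϖ 1)^{-N})` is the global scalar matrix of the idele `(localUnits v ϖ)^{-N}`
    set w : ideleGroup K := (localUnits v ϖ)⁻¹ ^ N with hw
    have hsc : GLn.ofLocal n K v ((heckeDiag n ϖ n)⁻¹ ^ N) = Matrix.GeneralLinearGroup.scalar (Fin n) w := by
      rw [map_pow, map_inv, heckeDiag_self_eq_scalar, ← glDiagonal_const_eq_scalar, ofLocal_glDiagonal_const,
        hw, map_pow, map_inv]
    have hcomm : ∀ y : GL (Fin n) (AdeleRing (𝓞 K) K),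
        y * Matrix.GeneralLinearGroup.scalar (Fin n) w = Matrix.GeneralLinearGroup.scalar (Fin n) w * y :=
      fun y => (Subgroup.mem_center_iff.1 (generalLinearGroup_scalar_mem_center (n := n) (K := K) w)) y
    have h : ∀ u : GL (Fin n) (AdeleRing (𝓞 K) K),
        φ (u * (D * (g * Matrix.GeneralLinearGroup.scalar (Fin n) w))) = ((ω w : ℂˣ) : ℂ) * φ (u * (D * g)) :=
      fun u => by
      rw [← mul_assoc D, hcomm (D * g), ← mul_assoc, hcomm u, mul_assoc]
      exact hωφ η f w (u * (D * g))
    refine ⟨((ω w : ℂˣ) : ℂ), ?_⟩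
    show W (D * (g * GLn.ofLocal n K v ((heckeDiag n ϖ n)⁻¹ ^ N))) = _ * W (D * g)
    rw [hsc]
    simp only [hW, whittakerCoeff_def, h, mul_assoc]
    rw [integral_const_mul]
    exact (mul_smul_comm _ _ _).symm
  -- `N_n(𝔸_K)`-equivariance of `W^τ` under `ι_v(N_n(K_v))`: conjugate the unipotent past `diag(τ)`
  have hN : ∀ (v : HeightOneSpectrum (𝓞 K)), ∀ u ∈ upperUnitriangular (Fin n) (v.adicCompletion K),
      ∀ g : GL (Fin n) (AdeleRing (𝓞 K) K), ∃ c : ℂ, WT (GLn.ofLocal n K v u * g) = c * WT g := by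
    intro v u hu g
    set U : ↥(adelicUnipotent n K) := unipotentDiagConj τ ⟨GLn.ofLocal n K v u, ofLocal_mem_adelicUnipotent hu⟩
      with hU
    have hconj : D * (GLn.ofLocal n K v u * g) = (U : GL (Fin n) (AdeleRing (𝓞 K) K)) * (D * g) := by
      rw [hU, coe_unipotentDiagConj]
      simp only [hD, mul_assoc, inv_mul_cancel_left]
    refine ⟨whittakerCharFun (adeleAddChar K) U, ?_⟩
    show W (D * (GLn.ofLocal n K v u * g)) = _ * W (D * g)
    rw [hconj]
    exact whittakerCoeff_unipotent_mul h𝓕 hψ hφinv U (D * g)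
  obtain ⟨g, hgint, hg⟩ := exists_apply_ne_zero_forall_localComponent_mem_glInt hT hN hg₀'
  exact ⟨g, sndHom_mem_glFiniteIntegralLevel_of_forall_localComponent_mem_glInt hgint, hg⟩

end LevelOneTranslate

end Literature.NumberTheory.Automorphic
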